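import Mathlib
import HarnessLib
import Literature.Analysis.FluidPDE.SelfSimilar
import Literature.Analysis.FluidPDE.VectorCalculus
import Literature.Analysis.FluidPDE.Vorticity
import Summits.NavierStokesRegularity.NavierStokesRegularity.Theses.ThreadingFlux

/-!
# Crux idea «flux-starved-dipoles» — typed sketch (planner ns-idea-15 g12, lens «negation»)

Crux: stmt-NavierStokesRegularity-1222 `…Theses.ThreadingFlux.PoloidalLiouville`; wall W1 = registered stub
`stub_scalarLiouville` (antidynamo skeleton v2, ns-idea-6; verbatim copy `KinematicShadow.WallShape`).
NS regularity is NOT proved; `PoloidalLiouville` ⟨1222⟩, `stub_scalarLiouville`, `KinematicShadowSteady/Ancient` (g6) are OPEN;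
nothing in this file proves them.  Props + kernel-checked glue only, no `sorry`.

LABEL / SCOPE (critic ns-wall-crit-1 V28, PASS-WITH-PRICE, prices P1–P5 paid by ns-idea-15 g13): K1 `DipoleNeverSteady`,
K1′ `DipoleNeverAncient` and C2 `DipolarWindowIrrotational` are PAPER-proved (card §Proof) — the kernel holds ONLY the glue theorems and
the ring identity `averaged_cancellation` until `FluxStarvationSteady` / `FluxStarvation` land; SCOPE l = 1 ONLY — the flux identity (★)
has no c-independent analogue for l ≥ 2; `DipoleStratumOfWall` is CONDITIONAL on the antidynamo skeleton's two UNPROVED stubs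
`StubToroidalPotential` and `StubConstantOfIrrotational` (named again in its docstring).

THE OBJECT.  The DIPOLE STRATUM of the wall / of g6's kinematic shadow: toroidal potentials that are affine–zonal on every
sphere about `x₀`, with an `r`-dependent amplitude AND AXIS,
    `T(x) = ⟪A(r), x − x₀⟫ / r + R(r)`,  `r = ‖x − x₀‖`,  `A : (0,∞) → ℝ³`, `R : (0,∞) → ℝ`,
equivalently the «turning Hill / shellular rigid-rotation» fields `B = ∇T × (x − x₀) = A(r) × ξ = Ω(r) × (x − x₀)`.
Three free functions of `r`; non-axisymmetric as soon as the axis `Â(r)` turns.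

THE LEVER (flux starvation).  On a dipolar sphere the loop law (radial part of (E1)) makes the radial drift `u_r = M(c,r)/r`
a function of the latitude `c = T|_{S_r}`; the reduced scalar law (tangential part of (E1)) and incompressibility, AVERAGED over
the latitude circles of the moving axis, give the c-INDEPENDENT identity `(a − r a′)·M = −r²(ℓ − ∂ₜa)` (`a = ‖A‖`,
`ℓ = ⟪A″ + (2/r)A′ − (2/r²)A, Â⟫ = a″ + 2a′/r − 2a/r² − a‖Â′‖²`); zero net flux of `u` through `S_r` then forces `M ≡ 0` on every
NON-SOLID dipolar sphere (`a ≠ r a′`) and `ℓ = ∂ₜa` on all of `{a > 0}` — for EVERY `C¹` incompressible drift, bounded or not,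
coupled to `T` or not.  Consequences typed below:
* `DipoleNeverSteady` (K1, paper-proved): no steady dipole is maintained by any incompressible drift on ℝ³ — the amplitude
  `w = r a` is convex (`w″ = (2/r² + ‖Â′‖²) w`), `w(0⁺) = 0`, `w ≤ C r`: impossible (`ConvexEndgame`); kernel composition
  `dipoleNeverSteady_of : AmplitudeLawSteady → ConvexEndgame → DipoleNeverSteady`.
* `DipoleNeverAncient` (K1′, paper-proved): the ancient version — `q = a/r` is a non-negative ancient subcaloric function of the
  radial heat equation in ℝ⁵ with `q ≤ C/r`; parabolic mean value kills it.
* `SphereTangentUnthreadedVanishes` (L0, classical Mie/Backus): an incompressible field tangent to the spheres of a shell and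
  unthreaded there vanishes there (tangent + solenoidal ⇒ surface stream function ψ; radial vorticity = −Δ_{S}ψ = 0 ⇒ ψ const).
* `NonSolidDipolarShellAtRest` (= flux starvation + L0, kernel glue `nonSolidDipolarShellAtRest_of`) and the NS-side corollary
  `DipolarWindowIrrotational` (paper): an unthreaded incompressible flow whose own toroidal potential is dipolar on every sphere
  on a time window is irrotational there — the dipole stratum of W1 AND of W2 (27585) is EMPTY, not merely rigid, on windows,
  without analyticity, ancientness, jets or KNSS.
Distinct from: g6 rungs A/A′/C (r-RIGID profile classes, head transport at the far end); ns-idea-13 `CapSym.TwistedCapNoTwist`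
(Biot–Savart-COUPLED, radial part of (E1) only ⇒ no twist, then KNSS); g3 `PureDegreeShapeRigidity` (order-one JETS at an
analytic centre).  Here: arbitrary drift, tangential part of (E1) + zero flux, global in `r`, no analyticity.
-/

set_option linter.dupNamespace false

namespace Summit.NavierStokesRegularity.NavierStokesRegularity.Cruxes.PoloidalLiouville.FluxStarvedDipole

open scoped Topology RealInnerProductSpace
open Filter Set Function

local notation "E" => EuclideanSpace ℝ (Fin 3)

/-! ### The laws (verbatim shapes of g6's `KinematicShadow.SteadyKinematicLawOn` / `KinematicLaw`, restated here so that this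
file does not depend on the build state of another Cruxes workfile; items are deduplicated by signature) -/

/-- The STEADY KINEMATIC LAW on `U` (= `KinematicShadow.SteadyKinematicLawOn`, verbatim): (E1) with `∂ₜT = 0` for a drift `u`
and a potential `T`, i.e. the steady induction equation for `B = ∇T × (x − x₀)` written on the potential. -/
def SteadyKinematicLawOn (u : E → E) (T : E → ℝ) (x₀ : E) (U : Set E) : Prop :=
  ∀ x ∈ U,
    Literature.Analysis.FluidPDE.cross
        (gradient (fun z => inner ℝ (u z) (gradient T z) - Laplacian.laplacian T z) x) (x - x₀) =
      Literature.Analysis.FluidPDE.cross (gradient (fun z => inner ℝ (u z) (z - x₀)) x) (gradient T x)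

/-! ### The stratum -/

/-- The DIPOLE (affine–zonal, turning-axis) toroidal potential about `x₀` with moment curve `A` and radial part `R`:
`T(x) = ⟪A(‖x−x₀‖), x−x₀⟫/‖x−x₀‖ + R(‖x−x₀‖)` (junk value `R 0` at `x₀`; every law below is imposed on `{x₀}ᶜ`). -/
noncomputable def dipolePotential (x₀ : E) (A : ℝ → E) (R : ℝ → ℝ) : E → ℝ :=
  fun x => inner ℝ (A ‖x - x₀‖) (x - x₀) / ‖x - x₀‖ + R ‖x - x₀‖

/-- Time-dependent dipole potential, slice by slice. -/
noncomputable def dipolePotentialT (x₀ : E) (A : ℝ → ℝ → E) (R : ℝ → ℝ → ℝ) : ℝ → E → ℝ :=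
  fun t => dipolePotential x₀ (A t) (R t)

/-- The amplitude `w(r) = r·‖A(r)‖` of a dipole (`= r·a(r)`; `‖B‖ ≤ a` on `S_r`). -/
noncomputable def amplitude (A : ℝ → E) : ℝ → ℝ := fun r => r * ‖A r‖

/-- A dipolar sphere `S_r(x₀)` is SOLID when `a(r) = r·a′(r)` (locally `a = C·r`: Hill-type cores `B = C·Â(r) × (x − x₀)`);
flux starvation bites exactly on the non-solid spheres. -/
def IsNonSolidAt (A : ℝ → E) (r : ℝ) : Prop :=
  A r ≠ 0 ∧ r * deriv (fun s => ‖A s‖) r ≠ ‖A r‖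

/-- The time-dependent kinematic law (E1) on a time set `S` (g6's `KinematicLaw` is the case `S = (−∞,0)`): the induction
equation for `B = ∇T × (x − x₀)` under the drift `u`, written on the potential, on `S × {x₀}ᶜ`. -/
def KinematicLawOn (S : Set ℝ) (u : ℝ → E → E) (T : ℝ → E → ℝ) (x₀ : E) : Prop :=
  ∀ t ∈ S, ∀ x, x ≠ x₀ →
    Literature.Analysis.FluidPDE.cross
        (gradient (fun z => deriv (fun s => T s z) t + inner ℝ (u t z) (gradient (T t) z)
          - Laplacian.laplacian (T t) z) x) (x - x₀) =
      Literature.Analysis.FluidPDE.cross (gradient (fun z => inner ℝ (u t z) (z - x₀)) x) (gradient (T t) x)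

/-! ### Flux starvation (the lever) -/

/-- FLUX STARVATION, steady form (paper-proved, card §Proof steps 1–3): a `C¹` incompressible drift `u` maintaining a steady
dipole potential is TANGENT to every non-solid dipolar sphere.  Proof: loop law `⟪u, x−x₀⟫ = M(c,r)` on latitude circles
(radial part of (E1)); reduced scalar law `ΔT − ⟪u,∇T⟫ = N(c,r)`, `N_c = M_r/r` (tangential part); the incompressibility
condition averaged over the latitude circles of `Â(r)` collapses (the `M_c`- and `M_r`-terms cancel) to `(a − r a′)M = −r²ℓ`,
c-independent; zero flux `∮_{S_r}⟪u, ξ⟫ = 0` ⇒ `M(·,r) = 0` whenever `a(r) ≠ r a′(r)`.  No bound on `u`, no coupling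
`curl u = ∇T × (x−x₀)`, no smoothness of `T` at `x₀`. -/
def FluxStarvationSteady : Prop :=
  ∀ (u : E → E) (x₀ : E) (A : ℝ → E) (R : ℝ → ℝ),
    ContDiff ℝ 1 u → Literature.Analysis.FluidPDE.VectorCalculus.IsDivFree u →
    ContDiffOn ℝ 3 A (Set.Ioi 0) → ContDiffOn ℝ 3 R (Set.Ioi 0) →
    SteadyKinematicLawOn u (dipolePotential x₀ A R) x₀ ({x₀}ᶜ : Set E) →
    ∀ r > 0, IsNonSolidAt A r → ∀ x, ‖x - x₀‖ = r → inner ℝ (u x) (x - x₀) = 0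

/-- FLUX STARVATION, time-dependent form on a time set `S` (paper-proved; the `∂ₜT`-term only shifts `ℓ ↦ ℓ − ∂ₜa` in the
c-independent identity, so the conclusion is unchanged): at each time, the drift is tangent to every non-solid dipolar sphere. -/
def FluxStarvation : Prop :=
  ∀ (S : Set ℝ) (u : ℝ → E → E) (x₀ : E) (A : ℝ → ℝ → E) (R : ℝ → ℝ → ℝ), IsOpen S →
    (∀ t ∈ S, ContDiff ℝ 1 (u t)) → (∀ t ∈ S, Literature.Analysis.FluidPDE.VectorCalculus.IsDivFree (u t)) →
    ContDiffOn ℝ 3 (Function.uncurry A) (S ×ˢ Set.Ioi 0) → ContDiffOn ℝ 3 (Function.uncurry R) (S ×ˢ Set.Ioi 0) →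
    KinematicLawOn S u (dipolePotentialT x₀ A R) x₀ →
    ∀ t ∈ S, ∀ r > 0, IsNonSolidAt (A t) r → ∀ x, ‖x - x₀‖ = r → inner ℝ (u t x) (x - x₀) = 0

/-- KERNEL (the algebraic heart of (★), card §Proof step 3): after averaging over a latitude circle, `r²a·[r⁻²(M + r a′ z M_c + r M_r)]
+ r·[r(ℓ − ∂ₜa) − a′M − a a′ z M_c − a M_r] = (a − r a′)·M + r²(ℓ − ∂ₜa)` — every `M_c`- and `M_r`-term cancels, which is why the
identity is independent of the latitude `c`. -/
theorem averaged_cancellation (M Mc Mr a a' z r ℓ dta : ℝ) :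
    (a * M + r * a * a' * z * Mc + r * a * Mr) + r * (r * (ℓ - dta) - a' * M - a * a' * z * Mc - a * Mr)
      = (a - r * a') * M + r ^ 2 * (ℓ - dta) := by
  ring

/-- KERNEL (card §Proof step 4): the amplitude bookkeeping `w = r·a`: `r·(a″ + 2a′/r − 2a/r²) = w″ − 2w/r²` with `w″ = r a″ + 2a′`,
as a polynomial identity after clearing `r ≠ 0`. -/
theorem amplitude_bookkeeping (a a1 a2 r : ℝ) (hr : r ≠ 0) :
    r * (a2 + 2 * a1 / r - 2 * a / r ^ 2) = (r * a2 + 2 * a1) - 2 * (r * a) / r ^ 2 := by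
  field_simp

/-! ### K1: no steady dipole is maintained by any incompressible drift -/

/-- AMPLITUDE LAW (paper-proved, card §Proof step 4): with `M ≡ 0` on non-solid spheres and `ℓ = 0` on all of `{a > 0}`
(flux starvation; at solid points the identity `(a − ra′)M = −r²ℓ` gives `ℓ = 0` directly), the amplitude `w = r·a` satisfies
`w″ = (2/r² + ‖Â′‖²)·w ≥ 2w/r²` wherever `A ≠ 0` — typed as the inequality the endgame consumes. -/
def AmplitudeLawSteady : Prop :=
  ∀ (u : E → E) (x₀ : E) (A : ℝ → E) (R : ℝ → ℝ),
    ContDiff ℝ 1 u → Literature.Analysis.FluidPDE.VectorCalculus.IsDivFree u →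
    ContDiffOn ℝ 3 A (Set.Ioi 0) → ContDiffOn ℝ 3 R (Set.Ioi 0) →
    SteadyKinematicLawOn u (dipolePotential x₀ A R) x₀ ({x₀}ᶜ : Set E) →
    ∀ r > 0, A r ≠ 0 →
      ContDiffAt ℝ 2 (amplitude A) r ∧ 2 * amplitude A r / r ^ 2 ≤ iteratedDeriv 2 (amplitude A) r

/-- CONVEX ENDGAME (paper-proved, 6 lines; pure one-variable analysis, Lean size S/M): a continuous `w ≥ 0` on `(0,∞)` with
`w ≤ C·r` which is `C²` with `w″ ≥ 2w/r²` wherever it is positive vanishes identically.  (On a component `(r₁,r₂)` of `{w>0}`,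
`w` is convex and tends to `0` at both finite ends — impossible — so `r₂ = ∞`; then `w(r)/(r−r₁) ↑`, `w ≥ k(r−r₁)`,
`w′(R) ≥ w′(r₀) + ∫ 2w/r² ≥ const + 2k·log R → ∞`, contradicting `w ≤ C·r`.) -/
def ConvexEndgame : Prop :=
  ∀ (w : ℝ → ℝ) (C : ℝ), ContinuousOn w (Set.Ioi 0) → (∀ r > 0, 0 ≤ w r) → (∀ r > 0, w r ≤ C * r) →
    (∀ r > 0, 0 < w r → ContDiffAt ℝ 2 w r ∧ 2 * w r / r ^ 2 ≤ iteratedDeriv 2 w r) →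
    ∀ r > 0, w r = 0

/-- K1 — NO STEADY DIPOLE IS MAINTAINED BY ANY INCOMPRESSIBLE DRIFT (paper-proved; kernel composition `dipoleNeverSteady_of`).
`u ∈ C¹(ℝ³)` divergence-free (NO bound), `A, R ∈ C³(0,∞)`, `‖A‖ ≤ C` (i.e. `T` bounded up to its radial part, `‖B‖ ≤ C`), the
steady kinematic law on `{x₀}ᶜ` ⇒ `A ≡ 0` (the field is zero).  The dipole stratum of `KinematicShadowSteady` is TRUE — for a
strictly larger drift class — so a kinematic toroidal equilibrium on ℝ³ (g6's open object), if any, is carried by the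
quadrupole-and-higher spherical content of its potential wherever the drift works. -/
def DipoleNeverSteady : Prop :=
  ∀ (u : E → E) (x₀ : E) (A : ℝ → E) (R : ℝ → ℝ) (C : ℝ),
    ContDiff ℝ 1 u → Literature.Analysis.FluidPDE.VectorCalculus.IsDivFree u →
    ContDiffOn ℝ 3 A (Set.Ioi 0) → ContDiffOn ℝ 3 R (Set.Ioi 0) →
    (∀ r > 0, ‖A r‖ ≤ C) →
    SteadyKinematicLawOn u (dipolePotential x₀ A R) x₀ ({x₀}ᶜ : Set E) →
    ∀ r > 0, A r = 0

/-- KERNEL: K1 from the amplitude law and the convex endgame (`w(0⁺) = 0` and `w ≤ C·r` come from `‖A‖ ≤ C` for free). -/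
theorem dipoleNeverSteady_of (h₁ : AmplitudeLawSteady) (h₂ : ConvexEndgame) : DipoleNeverSteady := by
  intro u x₀ A R C hu hdiv hA hR hC hlaw r hr
  have hw : ∀ s > 0, amplitude A s = 0 := by
    refine h₂ (amplitude A) C ?_ ?_ ?_ ?_
    · have hAn : ContinuousOn (fun s => ‖A s‖) (Set.Ioi 0) := hA.continuousOn.norm
      exact continuousOn_id.mul hAn
    · intro s hs
      exact mul_nonneg hs.le (norm_nonneg _)
    · intro s hs
      show s * ‖A s‖ ≤ C * s
      calc s * ‖A s‖ ≤ s * C := mul_le_mul_of_nonneg_left (hC s hs) hs.le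
        _ = C * s := mul_comm _ _
    · intro s hs hpos
      have hAs : A s ≠ 0 := by
        intro h0
        have : amplitude A s = 0 := by
          show s * ‖A s‖ = 0
          rw [h0, norm_zero, mul_zero]
        rw [this] at hpos
        exact lt_irrefl _ hpos
      exact h₁ u x₀ A R hu hdiv hA hR hlaw s hs hAs
  have h0 : r * ‖A r‖ = 0 := hw r hr
  rcases mul_eq_zero.mp h0 with h | h
  · exact absurd h hr.ne'
  · exact norm_eq_zero.mp h

/-- KERNEL (bookkeeping of the hypothesis classes): K1 has NO drift bound, so it yields in particular the dipole stratum of g6's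
bounded-drift shadow hypotheses. -/
theorem dipoleNeverSteady_bounded (h : DipoleNeverSteady) :
    ∀ (u : E → E) (x₀ : E) (A : ℝ → E) (R : ℝ → ℝ) (K C : ℝ),
      ContDiff ℝ 1 u → Literature.Analysis.FluidPDE.VectorCalculus.IsDivFree u → (∀ x, ‖u x‖ ≤ K) →
      ContDiffOn ℝ 3 A (Set.Ioi 0) → ContDiffOn ℝ 3 R (Set.Ioi 0) → (∀ r > 0, ‖A r‖ ≤ C) →
      SteadyKinematicLawOn u (dipolePotential x₀ A R) x₀ ({x₀}ᶜ : Set E) →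
      ∀ r > 0, A r = 0 :=
  fun u x₀ A R _K C hu hdiv _ hA hR hC hlaw => h u x₀ A R C hu hdiv hA hR hC hlaw

/-! ### K1′: the ancient dipole -/

/-- K1′ — NO ANCIENT DIPOLE (paper-proved, card §Proof step 5′): slices `u(t) ∈ C¹` divergence-free (no bound), `A, R` jointly
`C³` on `(−∞,0) × (0,∞)`, `‖A‖ ≤ C`, the time-dependent law (E1) on `(−∞,0) × {x₀}ᶜ` ⇒ `A ≡ 0`.  Mechanism: flux starvation
gives `∂ₜa = ℓ` on `{a>0}`, i.e. `∂ₜw = w″ − (2/r² + ‖∂_rÂ‖²)w` for `w = r a`; then `q := a/r = w/r² ≥ 0` is an ancient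
distributional SUBsolution of the radial heat equation of ℝ⁵ (`∂ₜq ≤ q″ + (4/r)q′`; kinks of `a = ‖A‖` are semiconvex, the
singular line `r = 0` is removable since `q ≤ C/r = o(r^{−3})`), and the parabolic mean-value inequality on cylinders
`Q_ρ ⊂ ℝ⁵ × ℝ` gives `q(x,t) ≤ c₅ ⨍⨍_{Q_ρ} q ≤ c·C/ρ → 0`.  (The same 5-D device as KNSS's `ω_θ/r`, here for `‖A‖/r`.) -/
def DipoleNeverAncient : Prop :=
  ∀ (u : ℝ → E → E) (x₀ : E) (A : ℝ → ℝ → E) (R : ℝ → ℝ → ℝ) (C : ℝ),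
    (∀ t < 0, ContDiff ℝ 1 (u t)) → (∀ t < 0, Literature.Analysis.FluidPDE.VectorCalculus.IsDivFree (u t)) →
    ContDiffOn ℝ 3 (Function.uncurry A) (Set.Iio 0 ×ˢ Set.Ioi 0) →
    ContDiffOn ℝ 3 (Function.uncurry R) (Set.Iio 0 ×ˢ Set.Ioi 0) →
    (∀ t < 0, ∀ r > 0, ‖A t r‖ ≤ C) →
    KinematicLawOn (Set.Iio 0) u (dipolePotentialT x₀ A R) x₀ →
    ∀ t < 0, ∀ r > 0, A t r = 0

/-! ### L0 (Mie/Backus) and the NS-side corollaries -/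

/-- L0 — SPHERE-TANGENT UNTHREADED SOLENOIDAL FIELDS VANISH (classical; paper 3 lines; Lean size M): if `u ∈ C¹(ℝ³)` is
divergence-free, tangent to the spheres `S_r(x₀)`, `r₁ < r < r₂`, and unthreaded about `x₀` there, then `u ≡ 0` on that shell.
(Tangent + solenoidal ⇒ `div_{S}u_tan = 0` on each sphere ⇒ `u_tan = ŷ × ∇_Sψ`, `H¹(S²) = 0`; the radial vorticity of such a
field is `−Δ_Sψ / r`-type, so unthreaded ⇒ `ψ` constant on each sphere ⇒ `u_tan = 0`.)  Rigid rotations are tangent and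
solenoidal but THREADED (`⟪y, 2e⟫ ≠ 0`) — the lemma's content is exactly the unthreadedness. -/
def SphereTangentUnthreadedVanishes : Prop :=
  ∀ (u : E → E) (x₀ : E) (r₁ r₂ : ℝ), 0 ≤ r₁ → r₁ < r₂ →
    ContDiff ℝ 1 u → Literature.Analysis.FluidPDE.VectorCalculus.IsDivFree u →
    (∀ x, r₁ < ‖x - x₀‖ → ‖x - x₀‖ < r₂ → inner ℝ (u x) (x - x₀) = 0) →
    (∀ x, r₁ < ‖x - x₀‖ → ‖x - x₀‖ < r₂ →
        inner ℝ (x - x₀) (Literature.Analysis.FluidPDE.curl u x) = 0) →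
    ∀ x, r₁ < ‖x - x₀‖ → ‖x - x₀‖ < r₂ → u x = 0

/-- NON-SOLID DIPOLAR SHELLS ARE AT REST (steady form; kernel composition `nonSolidDipolarShellAtRest_of`): an unthreaded
incompressible `C¹` field `v` which, AS A DRIFT, maintains some steady dipole potential that is non-solid on the shell
`r₁ < ‖x−x₀‖ < r₂`, vanishes on that shell.  The coupling `curl v = ∇T × (x−x₀)` is NOT needed for this step. -/
def NonSolidDipolarShellAtRest : Prop :=
  ∀ (v : E → E) (x₀ : E) (A : ℝ → E) (R : ℝ → ℝ) (r₁ r₂ : ℝ), 0 ≤ r₁ → r₁ < r₂ →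
    ContDiff ℝ 1 v → Literature.Analysis.FluidPDE.VectorCalculus.IsDivFree v →
    ContDiffOn ℝ 3 A (Set.Ioi 0) → ContDiffOn ℝ 3 R (Set.Ioi 0) →
    (∀ x, r₁ < ‖x - x₀‖ → ‖x - x₀‖ < r₂ →
        inner ℝ (x - x₀) (Literature.Analysis.FluidPDE.curl v x) = 0) →
    SteadyKinematicLawOn v (dipolePotential x₀ A R) x₀ ({x₀}ᶜ : Set E) →
    (∀ r, r₁ < r → r < r₂ → IsNonSolidAt A r) →
    ∀ x, r₁ < ‖x - x₀‖ → ‖x - x₀‖ < r₂ → v x = 0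

/-- KERNEL: flux starvation + L0 ⇒ non-solid dipolar shells are at rest. -/
theorem nonSolidDipolarShellAtRest_of (hF : FluxStarvationSteady) (hL : SphereTangentUnthreadedVanishes) :
    NonSolidDipolarShellAtRest := by
  intro v x₀ A R r₁ r₂ hr₁ hr₁₂ hv hdiv hA hR hunthr hlaw hns x hx₁ hx₂
  refine hL v x₀ r₁ r₂ hr₁ hr₁₂ hv hdiv ?_ hunthr x hx₁ hx₂
  intro y hy₁ hy₂
  have hpos : 0 < ‖y - x₀‖ := lt_of_le_of_lt hr₁ hy₁
  exact hF v x₀ A R hv hdiv hA hR hlaw ‖y - x₀‖ hpos (hns ‖y - x₀‖ hy₁ hy₂) y rfl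

/-- THE SAME ON A TIME WINDOW (kernel composition `nonSolidDipolarShellAtRestOn_of`): at each time of an open time set `S`,
an unthreaded incompressible flow maintaining (as a drift) a dipole potential vanishes on every shell of non-solid spheres. -/
def NonSolidDipolarShellAtRestOn : Prop :=
  ∀ (S : Set ℝ) (v : ℝ → E → E) (x₀ : E) (A : ℝ → ℝ → E) (R : ℝ → ℝ → ℝ) (t r₁ r₂ : ℝ), IsOpen S → t ∈ S →
    0 ≤ r₁ → r₁ < r₂ →
    (∀ s ∈ S, ContDiff ℝ 1 (v s)) → (∀ s ∈ S, Literature.Analysis.FluidPDE.VectorCalculus.IsDivFree (v s)) →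
    ContDiffOn ℝ 3 (Function.uncurry A) (S ×ˢ Set.Ioi 0) → ContDiffOn ℝ 3 (Function.uncurry R) (S ×ˢ Set.Ioi 0) →
    (∀ x, r₁ < ‖x - x₀‖ → ‖x - x₀‖ < r₂ →
        inner ℝ (x - x₀) (Literature.Analysis.FluidPDE.curl (v t) x) = 0) →
    KinematicLawOn S v (dipolePotentialT x₀ A R) x₀ →
    (∀ r, r₁ < r → r < r₂ → IsNonSolidAt (A t) r) →
    ∀ x, r₁ < ‖x - x₀‖ → ‖x - x₀‖ < r₂ → v t x = 0

/-- KERNEL: time-dependent flux starvation + L0 ⇒ the window form. -/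
theorem nonSolidDipolarShellAtRestOn_of (hF : FluxStarvation) (hL : SphereTangentUnthreadedVanishes) :
    NonSolidDipolarShellAtRestOn := by
  intro S v x₀ A R t r₁ r₂ hS ht hr₁ hr₁₂ hv hdiv hA hR hunthr hlaw hns x hx₁ hx₂
  refine hL (v t) x₀ r₁ r₂ hr₁ hr₁₂ (hv t ht) (hdiv t ht) ?_ hunthr x hx₁ hx₂
  intro y hy₁ hy₂
  have hpos : 0 < ‖y - x₀‖ := lt_of_le_of_lt hr₁ hy₁
  exact hF S v x₀ A R hS hv hdiv hA hR hlaw t ht ‖y - x₀‖ hpos (hns ‖y - x₀‖ hy₁ hy₂) y rfl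

/-- NS-SIDE COROLLARY (paper-proved from `FluxStarvation` + L0 + a component argument; card §Proof step 6): DIPOLAR UNTHREADED
WINDOW FLOWS ARE IRROTATIONAL.  On an open time set `S`, slices `v(t) ∈ C¹` divergence-free, COUPLED `curl v(t) = ∇T(t) × (x−x₀)`
with `T` dipolar, moment `‖A‖ ≤ K` (e.g. bounded vorticity), (E1) on `S × {x₀}ᶜ` ⇒ `A ≡ 0` on `S`.  (On a component `(r₁,r₂)` of
`{a(t,·) > 0}` the non-solid set is open; if non-empty, the flow rests on a shell, so `curl v = 0` there and `A = 0` there —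
contradiction; hence `a = C(t)·r` on the component, which forces `r₂ = ∞` and contradicts `‖A‖ ≤ K` unless empty.)  This is the
degree-1 stratum of W2 (`UnthreadedRigidity`, 27585) decided with a STRONGER conclusion than W2's (at rest, not just
axisymmetric), on windows, with no analyticity / jets / KNSS; it is recorded as information, W2 movement 0 (the stratum is
where W2's conclusion was automatic). -/
def DipolarWindowIrrotational : Prop :=
  ∀ (S : Set ℝ) (v : ℝ → E → E) (x₀ : E) (A : ℝ → ℝ → E) (R : ℝ → ℝ → ℝ) (K : ℝ), IsOpen S →
    (∀ t ∈ S, ContDiff ℝ 2 (v t)) → (∀ t ∈ S, Literature.Analysis.FluidPDE.VectorCalculus.IsDivFree (v t)) →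
    ContDiffOn ℝ 3 (Function.uncurry A) (S ×ˢ Set.Ioi 0) → ContDiffOn ℝ 3 (Function.uncurry R) (S ×ˢ Set.Ioi 0) →
    (∀ t ∈ S, ∀ r > 0, ‖A t r‖ ≤ K) →
    (∀ t ∈ S, ∀ x, x ≠ x₀ →
        Literature.Analysis.FluidPDE.curl (v t) x =
          Literature.Analysis.FluidPDE.cross (gradient (dipolePotentialT x₀ A R t) x) (x - x₀)) →
    KinematicLawOn S v (dipolePotentialT x₀ A R) x₀ →
    ∀ t ∈ S, ∀ r > 0, A t r = 0

/-- The W1-class instance (bounded ancient mild, smooth, unthreaded, dipolar potential at all times ⇒ constant slices) is the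
conjunction of `DipolarWindowIrrotational` on `S = (−∞,0)` (or of `DipoleNeverAncient` with the drift `u := v`) with the
antidynamo skeleton's stub 3 `StubConstantOfIrrotational` (irrotational bounded slices are constant); typed for the record as the
dipole stratum of the crux.  STATUS (V28 P2): OPEN as a kernel fact; on paper it follows from the PAPER-proved C2/K1′ together with
TWO UNPROVED INPUTS of the antidynamo skeleton v2 (ns-idea-6, `…Cruxes.PoloidalLiouville.Antidynamo`): `StubToroidalPotential` (existence of
the toroidal potential `T` with (E1) from the Navier–Stokes equations for the unthreaded class — used to place a W1-class flow on this
stratum at all) and `StubConstantOfIrrotational` (bounded irrotational slices of a bounded ancient mild solution are constant); neither stub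
is proved in the tree; ⟨1222⟩ itself stays OPEN. -/
def DipoleStratumOfWall : Prop :=
  ∀ (v : ℝ → E → E) (x₀ : E) (A : ℝ → ℝ → E) (R : ℝ → ℝ → ℝ),
    Literature.Analysis.FluidPDE.IsBoundedAncientMildSolution 1 v →
    (∀ t < 0, MeasureTheory.AEStronglyMeasurable (v t) MeasureTheory.volume) →
    ContDiffOn ℝ (⊤ : ℕ∞) (Function.uncurry v) (Set.Iio 0 ×ˢ Set.univ) →
    ContDiffOn ℝ 3 (Function.uncurry A) (Set.Iio 0 ×ˢ Set.Ioi 0) →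
    ContDiffOn ℝ 3 (Function.uncurry R) (Set.Iio 0 ×ˢ Set.Ioi 0) →
    (∀ t < 0, ∀ x, x ≠ x₀ →
        Literature.Analysis.FluidPDE.curl (v t) x =
          Literature.Analysis.FluidPDE.cross (gradient (dipolePotentialT x₀ A R t) x) (x - x₀)) →
    ∀ t < 0, ∃ b : E, ∀ x, v t x = b

end Summit.NavierStokesRegularity.NavierStokesRegularity.Cruxes.PoloidalLiouville.FluxStarvedDipole
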